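import Literature.MathematicalPhysics.QuantumFieldTheory.Balaban1983to89.Setup
import Literature.MathematicalPhysics.QuantumLattice.GaugeGroups
import Literature.RepresentationTheory.CompactGroups.UnitaryTrick

/-!
# Bałaban's renormalization group for 4-d lattice Yang–Mills — the unitary matrix model of the gauge-group interface (`UnitaryModel`)

CITATION HEADER (lean-in-tree rule 2026-08-18). Companion to `Setup` (same series, same audit cell `pub-balaban`, unit b2b-balaban-f1):
T. Bałaban, *Comm. Math. Phys.* **98** 17–51 (1985) [Balaban1985Averaging] p. 20 ("`G` is a Lie subgroup of `U(N)`"), (17) p. 21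
(Hilbert–Schmidt norm `|X|² = Tr X*X`), (19) p. 21 (`|U - 1|` in the OPERATOR norm, and `|UV - 1| ≤ |U - 1| + |V - 1|`);
**109** 249–301 (1987) [Balaban1987RG1] (0.2) p. 252 (Wilson action with the NORMALIZED trace `tr`, `tr 1 = 1`). Standard facts on compact
groups from Th. Bröcker, T. tom Dieck, *Representations of Compact Lie Groups* (Springer GTM 98, 1985) [BrockerTomDieck1985] I (1.9)–(1.10)
(`U(n)`, `SU(n)` compact Lie groups), I (5.12)–(5.13) p. 48 (the normalized invariant integral: `∫ f(g) dg = ∫ f(hg) dg = ∫ f(gh) dg = ∫ f(g⁻¹) dg`, uniqueness).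
WHAT IS REPRODUCED: no theorem of the series. This module
(i) fixes ONE regularity mixin `RegularGaugeGroup` for a `GaugeGroup` with a measurable structure (measurability of multiplication,
inversion, `dist1`, `reTr`, and the two-sided bound `|reTr g| ≤ 1`) — exactly the standing hypotheses under which `MissingProofs` proves
measurability / integrability of the Wilson weight and `|⟨W⟩| ≤ 1` — so that later modules assume `[RegularGaugeGroup G]` instead of repeating
four hypotheses lemma by lemma (cell NOTATION.md Q6);
(ii) CONSTRUCTS the interface `GaugeGroup` of `Setup` on any group `H` from a unitary matrix representation `ρ : H →* M_n(ℂ)`, `ρ(H) ⊂ U(n)`,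
with `dist1 h = ‖ρ h - 1‖` in the L²-OPERATOR norm of `M_n(ℂ) = L(ℂⁿ)` (Mathlib scope `Matrix.Norms.L2Operator`; B7 (19)) and
`reTr h = Re Tr ρ(h) / n` (B12 (0.2)), all eleven interface identities being PROVED; instantiates it for Mathlib's `Matrix.unitaryGroup n ℂ`
and `Matrix.specialUnitaryGroup n ℂ` through the tree's fundamental representations (`Literature.MathematicalPhysics.QuantumLattice.GaugeGroups`),
proves `RegularGaugeGroup` for both (continuity + second countability, Borel structures of the tree), and packages the normalized Haar measure
`haarMeasure ⊤` (= the tree's `haarProbability`) of any compact group as `HaarData` (right and inversion invariance from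
`Literature.RepresentationTheory.CompactGroups.UnitaryTrick`: compact groups are unimodular).
This is the NON-VACUITY CERTIFICATE of the interfaces `GaugeGroup` / `HaarData` / `RegularGaugeGroup` (their axioms hold in the groups the
papers mean) and the bridge "abstract interface ↔ concrete matrix groups of the tree" announced as future work in the header of `Setup`.
Conventions recorded in the cell's DIVERGENCE.md row F11 (operator norm := Mathlib's L²-operator norm; `reTr := Re Tr / n`, an instance of the
schematic "normalized trace" of `Setup`; `n` nonempty).
-/

open scoped BigOperators Matrix
open _root_.MeasureTheory

namespace Literature.MathematicalPhysics.QuantumFieldTheory.Balaban1983to89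

/-! ## 1. The regularity mixin (NOTATION §3; closes NOTATION Q6) -/

/-- Regularity of a `GaugeGroup` carrying a measurable structure: multiplication and inversion are (jointly) measurable, the interface
functions `dist1 = |· - 1|` (B7 (19)) and `reTr = Re tr` (B12 (0.2)) are measurable, and `|Re tr g| ≤ 1`. These are precisely the standing
hypotheses of `MissingProofs` §§2–3 (`[MeasurableMul₂ G] [MeasurableInv G]`, `Measurable reTr`, `∀ g, |reTr g| ≤ 1`); every closed subgroup of
`U(n)` with its Borel σ-algebra satisfies them (instances for `U(n)`, `SU(n)` in §4 below). A `Prop`-valued mixin over the GIVEN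
`[GaugeGroup G] [MeasurableSpace G]`, so it adds no data and creates no diamonds. [cite: Balaban1985Averaging, (19) p.21] -/
class RegularGaugeGroup (G : Type*) [GaugeGroup G] [MeasurableSpace G] : Prop
    extends MeasurableMul₂ G, MeasurableInv G where
  measurable_dist1 : Measurable (dist1 : G → ℝ)
  measurable_reTr : Measurable (reTr : G → ℝ)
  abs_reTr_le_one : ∀ g : G, |reTr g| ≤ 1

namespace RegularGaugeGroup

variable {G : Type*} [GaugeGroup G] [MeasurableSpace G] [RegularGaugeGroup G]

/-- `-1 ≤ Re tr g` (lower half of `|Re tr g| ≤ 1`). [folklore] -/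
lemma neg_one_le_reTr (g : G) : -1 ≤ reTr g := (abs_le.mp (abs_reTr_le_one g)).1

/-- The plaquette action density `1 - Re tr U(∂p)` of B12 (0.2) takes values in `[0, 2]`. [cite: Balaban1987RG1, (0.2) p.252] -/
lemma one_sub_reTr_mem_Icc (g : G) : 1 - reTr g ∈ Set.Icc (0 : ℝ) 2 :=
  ⟨by linarith [GaugeGroup.reTr_le_one g], by linarith [neg_one_le_reTr g]⟩

end RegularGaugeGroup

/-! ## 2. The normalized Haar measure of a compact group as `HaarData` (NOTATION §8) -/

section Compact

variable (G : Type*) [GaugeGroup G] [TopologicalSpace G] [IsTopologicalGroup G] [CompactSpace G]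
  [MeasurableSpace G] [BorelSpace G]

/-- The normalized Haar measure `haarMeasure ⊤` of a compact group `G` with its Borel structure, packaged as the `HaarData` of `Setup`:
a probability measure (total mass of `⊤ = G` is `1`), left invariant (Haar), right invariant and inversion invariant (compact groups are
unimodular: `CompactGroup.isMulRightInvariant_of_isHaarMeasure`, `CompactGroup.isInvInvariant_of_isHaarMeasure` of the tree). A `def`, not a
global instance, so that a hand-given `HaarData` on some `G` never meets a second, non-defeq one; instances for `U(n)`, `SU(n)` in §4.
Its measure is by definition the tree's `haarProbability G` (`HaarData.ofCompactGroup_haar`). [cite: BrockerTomDieck1985, I (5.12)] -/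
@[reducible] noncomputable def HaarData.ofCompactGroup : HaarData G where
  haar := Measure.haarMeasure ⊤
  isProb := RepresentationTheory.CompactGroups.CompactGroup.isProbabilityMeasure_haarMeasure_top
  map_mul_left g := by
    haveI : LocallyCompactSpace G :=
      RepresentationTheory.CompactGroups.CompactGroup.locallyCompactSpace_of_compactSpace_group
    exact map_mul_left_eq_self _ g
  map_mul_right g := by
    haveI : LocallyCompactSpace G :=
      RepresentationTheory.CompactGroups.CompactGroup.locallyCompactSpace_of_compactSpace_group
    haveI := RepresentationTheory.CompactGroups.CompactGroup.isMulRightInvariant_of_isHaarMeasure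
      (Measure.haarMeasure (⊤ : TopologicalSpace.PositiveCompacts G))
    exact map_mul_right_eq_self _ g
  map_inv := by
    haveI : LocallyCompactSpace G :=
      RepresentationTheory.CompactGroups.CompactGroup.locallyCompactSpace_of_compactSpace_group
    haveI := RepresentationTheory.CompactGroups.CompactGroup.isInvInvariant_of_isHaarMeasure
      (Measure.haarMeasure (⊤ : TopologicalSpace.PositiveCompacts G))
    exact Measure.map_inv_eq_self _

/-- The measure of `HaarData.ofCompactGroup G` is the tree's normalized Haar probability measure `haarProbability G`
(`Literature.MathematicalPhysics.QuantumFieldTheory.ConstructiveQFTWave0`), definitionally. [folklore] -/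
lemma HaarData.ofCompactGroup_haar : (HaarData.ofCompactGroup G).haar = haarProbability G := rfl

end Compact

/-! ## 3. The unitary matrix model of `dist1` and `reTr` (B7 p. 20, (17), (19); B12 (0.2)) -/

namespace UnitaryModel

open scoped Matrix.Norms.L2Operator

section Trace

variable {n : Type*} [Fintype n]

/-- The normalized real trace `Re tr U := Re Tr U / n`, so that `tr 1 = 1` (B12 (0.2)). [cite: Balaban1987RG1, (0.2) p.252] -/
noncomputable def nReTr (U : Matrix n n ℂ) : ℝ := (Matrix.trace U).re / Fintype.card n

/-- `Re tr Uᴴ = Re tr U`. [folklore] -/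
lemma nReTr_conjTranspose (U : Matrix n n ℂ) : nReTr Uᴴ = nReTr U := by
  simp [nReTr, Matrix.trace_conjTranspose]

/-- `U ↦ Re tr U` is continuous. [folklore] -/
lemma continuous_nReTr : Continuous (nReTr : Matrix n n ℂ → ℝ) := by
  unfold nReTr
  exact (Complex.continuous_re.comp continuous_id.matrix_trace).div_const _

end Trace

variable {n : Type*} [Fintype n] [DecidableEq n]

/-- `|U - 1|`: distance to the identity in the OPERATOR norm on `M_n(ℂ) = L(ℂⁿ)` (B7 (19): "`|U(x) - 1| < ε` … in the sense of operator norm";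
Mathlib's L²-operator norm `Matrix.instL2OpNormedAddCommGroup`, scope `Matrix.Norms.L2Operator`). [cite: Balaban1985Averaging, (19) p.21] -/
noncomputable def opDist1 (U : Matrix n n ℂ) : ℝ := ‖U - 1‖

/-- `0 ≤ |U - 1|`. [folklore] -/
lemma opDist1_nonneg (U : Matrix n n ℂ) : 0 ≤ opDist1 U := norm_nonneg _

/-- `|1 - 1| = 0`. [folklore] -/
lemma opDist1_one : opDist1 (1 : Matrix n n ℂ) = 0 := by simp [opDist1]

/-- `|Uᴴ - 1| = |U - 1|`: the operator norm is invariant under taking adjoints. [folklore] -/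
lemma opDist1_conjTranspose (U : Matrix n n ℂ) : opDist1 Uᴴ = opDist1 U := by
  unfold opDist1
  rw [← Matrix.l2_opNorm_conjTranspose (U - 1), Matrix.conjTranspose_sub, Matrix.conjTranspose_one]

/-- A unitary matrix has operator norm `1` (`n` nonempty). [folklore] -/
lemma norm_of_mem_unitaryGroup [Nonempty n] {U : Matrix n n ℂ} (hU : U ∈ Matrix.unitaryGroup n ℂ) : ‖U‖ = 1 :=
  CStarRing.norm_of_mem_unitary hU

/-- `|V U W - 1| ≤ |U - 1|` when `V W = 1` and `‖V‖, ‖W‖ ≤ 1` (since `V U W - 1 = V (U - 1) W`). [folklore] -/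
lemma opDist1_conj_le {U V W : Matrix n n ℂ} (hVW : V * W = 1) (hV : ‖V‖ ≤ 1) (hW : ‖W‖ ≤ 1) :
    opDist1 (V * U * W) ≤ opDist1 U := by
  unfold opDist1
  have h : V * U * W - 1 = V * (U - 1) * W := by rw [mul_sub, sub_mul, mul_one, hVW]
  rw [h]
  calc ‖V * (U - 1) * W‖ ≤ ‖V * (U - 1)‖ * ‖W‖ := Matrix.l2_opNorm_mul _ _
    _ ≤ (‖V‖ * ‖U - 1‖) * ‖W‖ := by gcongr; exact Matrix.l2_opNorm_mul _ _
    _ ≤ (1 * ‖U - 1‖) * 1 := by gcongr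
    _ = ‖U - 1‖ := by ring

/-- `|V U W - 1| = |U - 1|` when `V W = 1 = W V` and `‖V‖, ‖W‖ ≤ 1`: invariance of `|· - 1|` under conjugation by a unitary
(B7 p. 21: gauge invariance of the small-field conditions). [cite: Balaban1985Averaging, (19) p.21] -/
lemma opDist1_conj_eq {U V W : Matrix n n ℂ} (hVW : V * W = 1) (hWV : W * V = 1) (hV : ‖V‖ ≤ 1) (hW : ‖W‖ ≤ 1) :
    opDist1 (V * U * W) = opDist1 U := by
  refine le_antisymm (opDist1_conj_le hVW hV hW) ?_
  have h : W * (V * U * W) * V = U := by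
    calc W * (V * U * W) * V = (W * V) * U * (W * V) := by simp only [mul_assoc]
      _ = U := by rw [hWV, one_mul, mul_one]
  calc opDist1 U = opDist1 (W * (V * U * W) * V) := by rw [h]
    _ ≤ opDist1 (V * U * W) := opDist1_conj_le hWV hW hV

/-- `|U V - 1| ≤ |U - 1| + |V - 1|` when `‖U‖ ≤ 1` (B7 below (19), for unitary `U`; `U V - 1 = U (V - 1) + (U - 1)`).
[cite: Balaban1985Averaging, (19) p.21] -/
lemma opDist1_mul_le {U V : Matrix n n ℂ} (hU : ‖U‖ ≤ 1) : opDist1 (U * V) ≤ opDist1 U + opDist1 V := by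
  unfold opDist1
  have h : U * V - 1 = U * (V - 1) + (U - 1) := by noncomm_ring
  rw [h]
  calc ‖U * (V - 1) + (U - 1)‖ ≤ ‖U * (V - 1)‖ + ‖U - 1‖ := norm_add_le _ _
    _ ≤ ‖U‖ * ‖V - 1‖ + ‖U - 1‖ := by gcongr; exact Matrix.l2_opNorm_mul _ _
    _ ≤ 1 * ‖V - 1‖ + ‖U - 1‖ := by gcongr
    _ = ‖U - 1‖ + ‖V - 1‖ := by ring

/-- `Re tr 1 = 1` (normalization `tr 1 = 1` of B12 (0.2); `n` nonempty). [cite: Balaban1987RG1, (0.2) p.252] -/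
lemma nReTr_one [Nonempty n] : nReTr (1 : Matrix n n ℂ) = 1 := by
  have h : (Fintype.card n : ℝ) ≠ 0 := Nat.cast_ne_zero.mpr Fintype.card_ne_zero
  simp [nReTr, Matrix.trace_one, h]

/-- `|Re tr U| ≤ 1` for a unitary matrix `U` (its entries have modulus `≤ 1`, `entry_norm_bound_of_unitary`). [folklore] -/
lemma abs_nReTr_le_one {U : Matrix n n ℂ} (hU : U ∈ Matrix.unitaryGroup n ℂ) : |nReTr U| ≤ 1 := by
  unfold nReTr
  rcases isEmpty_or_nonempty n with hn | hn
  · simp [Fintype.card_eq_zero]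
  have hc : (0 : ℝ) < Fintype.card n := Nat.cast_pos.mpr Fintype.card_pos
  rw [abs_div, abs_of_pos hc, div_le_one hc]
  calc |(Matrix.trace U).re| ≤ ‖Matrix.trace U‖ := Complex.abs_re_le_norm _
    _ = ‖∑ i, U i i‖ := by simp [Matrix.trace]
    _ ≤ ∑ i, ‖U i i‖ := norm_sum_le _ _
    _ ≤ ∑ _i : n, (1 : ℝ) := Finset.sum_le_sum fun i _ => entry_norm_bound_of_unitary hU i i
    _ = Fintype.card n := by simp

/-- `Re tr U ≤ 1` for a unitary matrix `U`. [folklore] -/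
lemma nReTr_le_one {U : Matrix n n ℂ} (hU : U ∈ Matrix.unitaryGroup n ℂ) : nReTr U ≤ 1 :=
  (abs_le.mp (abs_nReTr_le_one hU)).2

/-- `Re tr (V U W) = Re tr U` when `W V = 1` (cyclicity of the trace; B12 p. 252: gauge invariance of the Wilson action). [folklore] -/
lemma nReTr_conj {U V W : Matrix n n ℂ} (hWV : W * V = 1) : nReTr (V * U * W) = nReTr U := by
  unfold nReTr
  rw [Matrix.trace_mul_comm, ← mul_assoc, hWV, one_mul]

/-- `U ↦ |U - 1|` is continuous (for the standard topology of `M_n(ℂ)`, which is the L²-operator-norm topology). [folklore] -/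
lemma continuous_opDist1 : Continuous (opDist1 : Matrix n n ℂ → ℝ) := by
  unfold opDist1
  exact (continuous_id.sub continuous_const).norm

section Rep

variable {H : Type*} [Group H] (ρ : H →* Matrix n n ℂ) (hρ : ∀ h, ρ h ∈ Matrix.unitaryGroup n ℂ)
include hρ

/-- A unitary matrix representation sends inverses to adjoints: `ρ(h⁻¹) = ρ(h)ᴴ`. [folklore] -/
lemma map_inv_eq_conjTranspose (h : H) : ρ h⁻¹ = (ρ h)ᴴ := by
  have h1 : (ρ h)ᴴ * ρ h = 1 := by
    simpa only [Matrix.star_eq_conjTranspose] using Matrix.mem_unitaryGroup_iff'.mp (hρ h)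
  calc ρ h⁻¹ = (ρ h)ᴴ * ρ h * ρ h⁻¹ := by rw [h1, one_mul]
    _ = (ρ h)ᴴ * ρ (h * h⁻¹) := by rw [mul_assoc, ← map_mul]
    _ = (ρ h)ᴴ := by rw [mul_inv_cancel, map_one, mul_one]

/-- Along a unitary representation: `|ρ(h⁻¹) - 1| = |ρ(h) - 1|`. [folklore] -/
lemma opDist1_map_inv (h : H) : opDist1 (ρ h⁻¹) = opDist1 (ρ h) := by
  rw [map_inv_eq_conjTranspose ρ hρ, opDist1_conjTranspose]

/-- Along a unitary representation: `|ρ(h g h⁻¹) - 1| = |ρ(g) - 1|` (`n` nonempty). [folklore] -/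
lemma opDist1_map_conj [Nonempty n] (g h : H) : opDist1 (ρ (h * g * h⁻¹)) = opDist1 (ρ g) := by
  rw [map_mul, map_mul]
  exact opDist1_conj_eq (by rw [← map_mul, mul_inv_cancel, map_one]) (by rw [← map_mul, inv_mul_cancel, map_one])
    (norm_of_mem_unitaryGroup (hρ h)).le (norm_of_mem_unitaryGroup (hρ h⁻¹)).le

/-- Along a unitary representation: `|ρ(g h) - 1| ≤ |ρ(g) - 1| + |ρ(h) - 1|` (B7 below (19); `n` nonempty). [cite: Balaban1985Averaging, (19) p.21] -/
lemma opDist1_map_mul_le [Nonempty n] (g h : H) : opDist1 (ρ (g * h)) ≤ opDist1 (ρ g) + opDist1 (ρ h) := by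
  rw [map_mul]
  exact opDist1_mul_le (norm_of_mem_unitaryGroup (hρ g)).le

/-- Along a unitary representation: `Re tr ρ(h⁻¹) = Re tr ρ(h)`. [folklore] -/
lemma nReTr_map_inv (h : H) : nReTr (ρ h⁻¹) = nReTr (ρ h) := by
  rw [map_inv_eq_conjTranspose ρ hρ, nReTr_conjTranspose]

omit hρ in
/-- Along a representation: `Re tr ρ(h g h⁻¹) = Re tr ρ(g)`. [folklore] -/
lemma nReTr_map_conj (g h : H) : nReTr (ρ (h * g * h⁻¹)) = nReTr (ρ g) := by
  rw [map_mul, map_mul]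
  exact nReTr_conj (by rw [← map_mul, inv_mul_cancel, map_one])

end Rep

end UnitaryModel

/-- The `GaugeGroup` structure (interface of `Setup`) induced on a group `H` by a unitary matrix representation `ρ : H →* M_n(ℂ)` with
`ρ(H) ⊂ U(n)` (B7 p. 20: "`G` is a Lie subgroup of `U(N)`"): `dist1 h = |ρ(h) - 1|` in the operator norm (B7 (19)) and `reTr h = Re tr ρ(h)`
with the normalized trace (B12 (0.2)). All eleven interface identities are PROVED (`UnitaryModel.*`), which certifies that the interface is
satisfiable by the intended groups; `n` must be nonempty (`tr 1 = 1`). Reducible, so that the underlying `Group` of the result is seen by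
instance search to be the given one. [cite: Balaban1985Averaging, (19) p.21] -/
@[reducible] noncomputable def GaugeGroup.ofUnitaryRep {n : Type*} [Fintype n] [DecidableEq n] [Nonempty n] (H : Type*) [Group H]
    (ρ : H →* Matrix n n ℂ) (hρ : ∀ h, ρ h ∈ Matrix.unitaryGroup n ℂ) : GaugeGroup H where
  toGroup := ‹Group H›
  dist1 h := UnitaryModel.opDist1 (ρ h)
  reTr h := UnitaryModel.nReTr (ρ h)
  dist1_nonneg h := UnitaryModel.opDist1_nonneg (ρ h)
  dist1_one := by
    show UnitaryModel.opDist1 (ρ 1) = 0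
    rw [map_one, UnitaryModel.opDist1_one]
  dist1_inv h := by
    show UnitaryModel.opDist1 (ρ h⁻¹) = UnitaryModel.opDist1 (ρ h)
    exact UnitaryModel.opDist1_map_inv ρ hρ h
  dist1_conj g h := by
    show UnitaryModel.opDist1 (ρ (h * g * h⁻¹)) = UnitaryModel.opDist1 (ρ g)
    exact UnitaryModel.opDist1_map_conj ρ hρ g h
  dist1_mul_le g h := by
    show UnitaryModel.opDist1 (ρ (g * h)) ≤ UnitaryModel.opDist1 (ρ g) + UnitaryModel.opDist1 (ρ h)
    exact UnitaryModel.opDist1_map_mul_le ρ hρ g h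
  reTr_one := by
    show UnitaryModel.nReTr (ρ 1) = 1
    rw [map_one, UnitaryModel.nReTr_one]
  reTr_le_one h := UnitaryModel.nReTr_le_one (hρ h)
  reTr_inv h := by
    show UnitaryModel.nReTr (ρ h⁻¹) = UnitaryModel.nReTr (ρ h)
    exact UnitaryModel.nReTr_map_inv ρ hρ h
  reTr_conj g h := by
    show UnitaryModel.nReTr (ρ (h * g * h⁻¹)) = UnitaryModel.nReTr (ρ g)
    exact UnitaryModel.nReTr_map_conj ρ g h

section OfUnitaryRep

variable {n : Type*} [Fintype n] [DecidableEq n] [Nonempty n] {H : Type*} [Group H]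
  (ρ : H →* Matrix n n ℂ) (hρ : ∀ h, ρ h ∈ Matrix.unitaryGroup n ℂ)

/-- In the model, `dist1 h = ‖ρ h - 1‖` (unfolding lemma). [folklore] -/
lemma GaugeGroup.ofUnitaryRep_dist1 (h : H) :
    (GaugeGroup.ofUnitaryRep H ρ hρ).dist1 h = UnitaryModel.opDist1 (ρ h) := rfl

/-- In the model, `reTr h = Re Tr ρ(h) / n` (unfolding lemma). [folklore] -/
lemma GaugeGroup.ofUnitaryRep_reTr (h : H) :
    (GaugeGroup.ofUnitaryRep H ρ hρ).reTr h = UnitaryModel.nReTr (ρ h) := rfl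

/-- In the model, `|Re tr h| ≤ 1` (the extra bound demanded by `RegularGaugeGroup`). [folklore] -/
lemma GaugeGroup.ofUnitaryRep_abs_reTr_le_one (h : H) :
    |(GaugeGroup.ofUnitaryRep H ρ hρ).reTr h| ≤ 1 := UnitaryModel.abs_nReTr_le_one (hρ h)

end OfUnitaryRep

/-! ## 4. Instances: `U(n)` and `SU(n)` (B7 p. 20; Bröcker–tom Dieck I (1.9)–(1.10)) -/

section Instances

open Literature.MathematicalPhysics.QuantumLattice

variable {n : Type*} [DecidableEq n] [Fintype n] [Nonempty n]

omit [DecidableEq n] [Nonempty n] in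
/-- `M_n(ℂ)` is second countable (the `Matrix` type synonym hides the `Pi` instance from instance search; used for the joint
measurability of multiplication on `U(n)`, `SU(n)`). [folklore] -/
theorem secondCountableTopology_matrix : SecondCountableTopology (Matrix n n ℂ) :=
  inferInstanceAs (SecondCountableTopology (n → n → ℂ))

/-- `U(n) = Matrix.unitaryGroup n ℂ` as a `GaugeGroup`, through its fundamental representation (the inclusion into `M_n(ℂ)`,
`unitaryFundamentalRep` of the tree): `dist1 U = ‖U - 1‖_{op}`, `reTr U = Re Tr U / n`. [cite: Balaban1985Averaging, (19) p.21] -/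
noncomputable instance instGaugeGroupUnitaryGroup : GaugeGroup (Matrix.unitaryGroup n ℂ) :=
  GaugeGroup.ofUnitaryRep _ (unitaryFundamentalRep n ℂ) fun U => U.2

/-- `SU(n) = Matrix.specialUnitaryGroup n ℂ` as a `GaugeGroup`, through its fundamental representation (`fundamentalRep` of the tree,
values in `U(n)` by `fundamentalRep_mem_unitaryGroup`). [cite: Balaban1985Averaging, (19) p.21] -/
noncomputable instance instGaugeGroupSpecialUnitaryGroup : GaugeGroup (Matrix.specialUnitaryGroup n ℂ) :=
  GaugeGroup.ofUnitaryRep _ (fundamentalRep n) fundamentalRep_mem_unitaryGroup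

/-- `U(n)` with its Borel σ-algebra (`Matrix.unitaryGroup.instMeasurableSpace` of the tree) is a `RegularGaugeGroup`: the group operations are
continuous on a second-countable Borel space, `dist1`, `reTr` are continuous, `|Re tr U| ≤ 1`. [cite: BrockerTomDieck1985, I (1.9)] -/
instance instRegularGaugeGroupUnitaryGroup : RegularGaugeGroup (Matrix.unitaryGroup n ℂ) where
  toMeasurableMul₂ := by
    haveI := secondCountableTopology_matrix (n := n)
    haveI : SecondCountableTopology (Matrix.unitaryGroup n ℂ) := Topology.IsEmbedding.subtypeVal.secondCountableTopology
    infer_instance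
  toMeasurableInv := inferInstance
  measurable_dist1 := (UnitaryModel.continuous_opDist1.comp (continuous_unitaryFundamentalRep n ℂ)).measurable
  measurable_reTr := (UnitaryModel.continuous_nReTr.comp (continuous_unitaryFundamentalRep n ℂ)).measurable
  abs_reTr_le_one U := UnitaryModel.abs_nReTr_le_one U.2

/-- `SU(n)` with its Borel σ-algebra (`Matrix.specialUnitaryGroup.instMeasurableSpace` of the tree) is a `RegularGaugeGroup`.
[cite: BrockerTomDieck1985, I (1.10)] -/
instance instRegularGaugeGroupSpecialUnitaryGroup : RegularGaugeGroup (Matrix.specialUnitaryGroup n ℂ) where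
  toMeasurableMul₂ := by
    haveI := secondCountableTopology_matrix (n := n)
    haveI : SecondCountableTopology (Matrix.specialUnitaryGroup n ℂ) :=
      Topology.IsEmbedding.subtypeVal.secondCountableTopology
    infer_instance
  toMeasurableInv := inferInstance
  measurable_dist1 := (UnitaryModel.continuous_opDist1.comp (continuous_fundamentalRep n)).measurable
  measurable_reTr := (UnitaryModel.continuous_nReTr.comp (continuous_fundamentalRep n)).measurable
  abs_reTr_le_one U := UnitaryModel.abs_nReTr_le_one (fundamentalRep_mem_unitaryGroup U)

/-- Normalized Haar measure on `U(n)` as `HaarData` (an instance of `HaarData.ofCompactGroup`; compactness of `U(n)` from the tree).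
[cite: BrockerTomDieck1985, I (5.12)] -/
noncomputable instance instHaarDataUnitaryGroup : HaarData (Matrix.unitaryGroup n ℂ) := HaarData.ofCompactGroup _

/-- Normalized Haar measure on `SU(n)` as `HaarData` (compactness and the topological-group structure of `SU(n)` from the tree).
[cite: BrockerTomDieck1985, I (5.12)] -/
noncomputable instance instHaarDataSpecialUnitaryGroup : HaarData (Matrix.specialUnitaryGroup n ℂ) := HaarData.ofCompactGroup _

/-- Sanity statement of the certificate: on `SU(n)` the interface functions are literally `‖U - 1‖_{op}` and `Re Tr U / n`, the Haar
data is the normalized Haar measure, and the regularity mixin is available by instance search. [folklore] -/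
example (U : Matrix.specialUnitaryGroup n ℂ) :
    dist1 U = UnitaryModel.opDist1 (U : Matrix n n ℂ) ∧ reTr U = UnitaryModel.nReTr (U : Matrix n n ℂ) ∧
      (HaarData.haar : Measure (Matrix.specialUnitaryGroup n ℂ)) = haarProbability (Matrix.specialUnitaryGroup n ℂ) ∧
      RegularGaugeGroup (Matrix.specialUnitaryGroup n ℂ) :=
  ⟨rfl, rfl, rfl, inferInstance⟩

end Instances

end Literature.MathematicalPhysics.QuantumFieldTheory.Balaban1983to89
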